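import Summits.QuantumFields.BalabanUV.Beta.GAN24.ContactFaceJumpStaircase
import Summits.QuantumFields.BalabanUV.Beta.GAN24.EnvelopeBlockSum
import Summits.QuantumFields.BalabanUV.Beta.AveragingLinearGaugeVH

/-!
# `GAN24.ContactGaugeStaircaseLocal` — CT-ROUTE, the row owner's `gen20/BORNSEC-PLAN-v1.md` v1.1 §0 (c2) ∕ §A (Λ-C) **(C4) PART 2: THE LETTERS OF A GAUGE STAIRCASE
# ON THE SUPPORT OF ONE COARSE BOND WITH THE SOURCE ENVELOPE KEPT** — for pieces `|G s (blk (Lc^s) u)| ≤ α·Lc^s·e^{−κ₀‖quo (Lc^{n+1}) u − z₀‖∞}` (the shape of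
# leaf-01's `ContactGaugeStaircase.abs_gaugePiece_le` for the route's bond gauge function, source label `z₀`), the finest-piece four-site weight and gradient on
# `nearBox Lc y` and the jump sum across the bond `(μ, y)` are their letters (`4α`, `2α`, `Σ_{s<n} [Lc^s ∣ y_μ+1]·2·α·Lc^{s+1}`) TIMES ONE envelope value
# `e^{2(d+1)κ₀}·e^{−κ₀‖quo (Lc^n) y − z₀‖∞}` of the bond — the localised twin of leaf-01 g60's `ContactFaceJumpStaircase.sum_abs_jump_routeGauge_le_three`
# (there the envelope is dropped to `1`, which is exact for the (μ,y)-COUNT but loses the localisation in the source label that `LocStencil` asks)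
# (OWNER gan24-p1-g21 [GAN24P1-G21-ONLINE] (W1) «(C4) IS YOURS»; journal `CLAIMS.log` l.34168 ∕ l.34465)

HONEST FRAMING (cell charter, verbatim): «discharging `BetaPertH` makes Bałaban's UV stability UNCONDITIONAL — a real constructive-QFT result;
it is NOT the continuum limit and NOT the Clay problem.»  DERIVED cell leaf (pub-balaban, G-an2-4 formalisation swarm → CRUX TEAM (2), seat
`b2b-balaban-gan24-formalise-leaf-02`, gen 49): [folklore] lattice bookkeeping (floor division, block labels, one exponential wobble) over leaf-12's
`EnvelopeBlockSum.env_wobble`, the owner's `StaircaseFaces.quo_quo` ∕ `blk_one` ∕ `l1_unitVec_eq_one`, an1's `blk_block` and leaf-01's `ContactFaceJumpStaircase.jump_eq_zero_of_not_dvd` BY NAME;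
generic `d`, ABSTRACT pieces `G s` under the displayed letter (the route's instance is PART 4); NO cited fact, NO `def`, NO `def … : Prop`, NO sorry, NO wall binder.
Discharges NO letter of (CONV-C); NEVER «G-an2-4 closed»; NOT hS0, NOT D1, NOT `BetaPertH`, NOT continuum, NOT Clay.  «not in print; our bookkeeping».
HONEST DEPENDENCY (cell records, verbatim): «continuum YM on T⁴ ⇐ BetaPertH ∧ nine spine estimates (0/9 proved); BetaPertH ⇐ (D1) ∧ (D4) ∧ CAP+tail;
G-an2-4 gates asym, D1 and NE2/3/4.»
ABSOLUTE RULE (cell charter, verbatim): «No internally-minted statement may enter as a cited fact. Every hypothesis is either kernel-proved in this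
package or a verbatim quotation of a PUBLISHED theorem with page reference. The manuscript(s) under audit are NOT citable for their own disputed steps —
they are the thing under adjudication; programme-internal (2001/route/tribunal) claims are never citable.»

## What is proved (generic `d`, `1 ≤ Lc`; `E(y) := e^{−κ₀‖quo (Lc^n) y − z₀‖∞}` the envelope of the bond `(μ,y)` at the source label, `κ₀ ≥ 0`)
* §1 LABELS: `quo_pow_succ` (`quo (Lc^{n+1}) p = quo (Lc^n) (quo Lc p)`), `abs_quo_sub_le_two` ∕ `l1_quo_sub_le` (a fine point `p` with `Lc·y ≤ p < Lc·y + 3Lc`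
  coordinatewise has `|quo Lc p − y|₁ ≤ 2(d+1)`: the support box `nearBox Lc y`, its unit translates, the root corner `Lc•y + ρ` and its coarse translate),
  **`env_label_le`** (`E_{n+1}(p) ≤ e^{2(d+1)κ₀}·E(y)` for such `p` — leaf-12's wobble one blocking up), `quo_pow_smul_blk` (`quo (Lc^{n+1}) (Lc^{s+1}•blk (Lc^s) y′) = quo (Lc^n) y′`, `s ≤ n`).
* §2 THE FINEST PIECE on the support of the bond: **`abs_weight_finest_le_env`** (`|G 0 x + G 0 (x+e_a) − G 0 (Lc•y+ρ) − G 0 (Lc•y+ρ+Lc•e_μ)| ≤ 4α·e^{2(d+1)κ₀}·E(y)`,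
  `x ∈ nearBox Lc y`) and **`abs_dz_finest_le_env`** (`|dz (G 0) a x| ≤ 2α·e^{2(d+1)κ₀}·E(y)`).
* §3 THE JUMPS across the bond: `abs_piece_blk_le_env` (`|G (s+1) (blk (Lc^s) y′)| ≤ α·Lc^{s+1}·e^{κ₀|y′−y|₁}·E(y)`), **`sum_abs_jump_le_env`**:
  `Σ_{s<n} |G (s+1) (blk (Lc^s) (y+e_μ)) − G (s+1) (blk (Lc^s) y)| ≤ (Σ_{s<n} [Lc^s ∣ y_μ+1]·2·(α·Lc^{s+1}))·(e^{2(d+1)κ₀}·E(y))` — leaf-03's face letter `F_μ(y)` with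
  `a (s+1) = α·Lc^{s+1}` VERBATIM, times the envelope.
USE (PART 3 `ContactLambdaEntryBound` ∕ PART 4 `BornLambdaContactLineage`, mine): the hypotheses `hW`, `hgb`, `hJ` of PART 1's `abs_commutator_le_of_staircase_of_env` ∕ `abs_commutator_dz_le_of_staircase_of_env` for the route's two bond
gauge functions `λ_{αx′}`, `λ_{βz′}` of one lineage (pieces by `ContactGaugeStaircase.gauge_eq_staircase` ∕ `abs_gaugePiece_le`, `n+1 = k−i`).
Provenance: seat b2b-balaban-gan24-formalise-leaf-02 gen 49 (prover-…-leaf-02-g49-0), 2026-08-21; over the files named above BY NAME.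
-/

noncomputable section

open Finset
open scoped BigOperators
open Literature.MathematicalPhysics.QuantumFieldTheory
open Literature.MathematicalPhysics.QuantumFieldTheory.LatticeForm (quo)
open Literature.MathematicalPhysics.QuantumFieldTheory.Balaban1983to89
open Literature.MathematicalPhysics.QuantumFieldTheory.Balaban1983to89.Beta
open B4ContourShift (supNorm supNorm_nonneg)
open B12Sec2to5 (l1 l1_nonneg)
open AffineAveraging (Form0 Form1 Site box toSite unitVec unitVec_apply dz)
open AveragingContours (blk blk_block)
open Summit.QuantumFields.BalabanUV.Beta.LinearGaugeVH (nearBox mem_nearBox)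
open Summit.QuantumFields.BalabanUV.Beta.GAN24.StaircaseFaces (quo_quo blk_one l1_unitVec_eq_one)
open Summit.QuantumFields.BalabanUV.Beta.GAN24.EnvelopeBlockSum (env_wobble env_le_one)
open Summit.QuantumFields.BalabanUV.Beta.GAN24.ContactFaceJumpStaircase (jump_eq_zero_of_not_dvd)

namespace Summit.QuantumFields.BalabanUV.Beta.GAN24.ContactGaugeStaircaseLocal

variable {d : ℕ} {Lc : ℕ}

/-! ## §1 Labels: one blocking up, the support of a coarse bond, the wobble -/

/-- [folklore] Nested floor division along the tower: `quo (Lc^{n+1}) p = quo (Lc^n) (quo Lc p)`. -/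
theorem quo_pow_succ (n : ℕ) (p : Site (d + 1)) : quo (Lc ^ (n + 1)) p = quo (Lc ^ n) (quo Lc p) := by
  rw [quo_quo, ← pow_succ']

/-- [folklore] A fine point within three blocks above the corner `Lc•y` has its `Lc`-label within `2` of `y`, coordinatewise. -/
theorem abs_quo_sub_le_two (hLc : 1 ≤ Lc) {y p : Site (d + 1)} (hp : ∀ i, (Lc : ℤ) * y i ≤ p i ∧ p i < (Lc : ℤ) * y i + 3 * Lc) (i : Fin (d + 1)) :
    |(quo Lc p - y) i| ≤ 2 := by
  have hL : (0 : ℤ) < Lc := by exact_mod_cast hLc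
  have h1 : y i ≤ p i / (Lc : ℤ) := (Int.le_ediv_iff_mul_le hL).2 (by rw [mul_comm]; exact (hp i).1)
  have h2 : p i / (Lc : ℤ) < y i + 3 := (Int.ediv_lt_iff_lt_mul hL).2 (by nlinarith [(hp i).2])
  simp only [Pi.sub_apply, quo]
  rw [abs_le]; constructor <;> omega

/-- [folklore] `ℓ¹` form: `|quo Lc p − y|₁ ≤ 2(d+1)` for such `p`. -/
theorem l1_quo_sub_le (hLc : 1 ≤ Lc) {y p : Site (d + 1)} (hp : ∀ i, (Lc : ℤ) * y i ≤ p i ∧ p i < (Lc : ℤ) * y i + 3 * Lc) :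
    l1 (quo Lc p - y) ≤ 2 * ((d : ℝ) + 1) := by
  unfold l1
  calc ∑ μ, |(((quo Lc p - y) μ : ℤ) : ℝ)| ≤ ∑ _μ : Fin (d + 1), (2 : ℝ) := Finset.sum_le_sum fun i _ => by
          rw [← Int.cast_abs]; exact_mod_cast abs_quo_sub_le_two hLc hp i
    _ = 2 * ((d : ℝ) + 1) := by rw [Finset.sum_const, Finset.card_univ, Fintype.card_fin, nsmul_eq_mul]; push_cast; ring

/-- [folklore] **THE ENVELOPE ONE BLOCKING UP** (leaf-12's `env_wobble` at blocking `Lc^n`): for a fine point `p` with `Lc·y ≤ p < Lc·y + 3Lc` coordinatewise,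
`e^{−κ₀‖quo (Lc^{n+1}) p − z₀‖∞} ≤ e^{2(d+1)κ₀}·e^{−κ₀‖quo (Lc^n) y − z₀‖∞}` (`κ₀ ≥ 0`, `Lc ≥ 1`). -/
theorem env_label_le (hLc : 1 ≤ Lc) {κ₀ : ℝ} (hκ : 0 ≤ κ₀) (n : ℕ) (z₀ : Site (d + 1)) {y p : Site (d + 1)}
    (hp : ∀ i, (Lc : ℤ) * y i ≤ p i ∧ p i < (Lc : ℤ) * y i + 3 * Lc) :
    Real.exp (-(κ₀ * supNorm (quo (Lc ^ (n + 1)) p - z₀)))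
      ≤ Real.exp (2 * ((d : ℝ) + 1) * κ₀) * Real.exp (-(κ₀ * supNorm (quo (Lc ^ n) y - z₀))) := by
  have hLn : 1 ≤ Lc ^ n := Nat.one_le_pow _ _ hLc
  rw [quo_pow_succ]
  refine (env_wobble (L := Lc ^ n) hLn hκ z₀ y (quo Lc p)).trans (mul_le_mul_of_nonneg_right ?_ (Real.exp_pos _).le)
  rw [Real.exp_le_exp]
  have h := l1_quo_sub_le (d := d) hLc hp
  nlinarith

/-- [folklore] The points of the support box: `x ∈ nearBox Lc y` ⇒ `Lc·y ≤ x < Lc·y + 3Lc` coordinatewise. -/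
theorem corner_le_of_mem_nearBox {y x : Site (d + 1)} (hx : x ∈ nearBox Lc y) (i : Fin (d + 1)) :
    (Lc : ℤ) * y i ≤ x i ∧ x i < (Lc : ℤ) * y i + 3 * Lc := by
  have h := (mem_nearBox.1 hx) i
  constructor <;> omega

/-- [folklore] … and their unit translates: `Lc·y ≤ x + e_a < Lc·y + 3Lc` (`Lc ≥ 1`). -/
theorem corner_le_of_mem_nearBox_add (hLc : 1 ≤ Lc) {y x : Site (d + 1)} (hx : x ∈ nearBox Lc y) (a i : Fin (d + 1)) :
    (Lc : ℤ) * y i ≤ (x + unitVec a) i ∧ (x + unitVec a) i < (Lc : ℤ) * y i + 3 * Lc := by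
  have h := (mem_nearBox.1 hx) i
  have hL : (1 : ℤ) ≤ Lc := by exact_mod_cast hLc
  simp only [Pi.add_apply, unitVec_apply]
  split_ifs <;> constructor <;> omega

/-- [folklore] The root corner `Lc•y + ρ` (`ρ = toSite rr`, `rr ∈ box`): `Lc·y ≤ Lc•y + ρ < Lc·y + 3Lc`. -/
theorem corner_le_root {rr : Fin (d + 1) → ℕ} (hrr : rr ∈ box (d + 1) Lc) (y : Site (d + 1)) (i : Fin (d + 1)) :
    (Lc : ℤ) * y i ≤ ((Lc : ℤ) • y + toSite rr) i ∧ ((Lc : ℤ) • y + toSite rr) i < (Lc : ℤ) * y i + 3 * Lc := by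
  have h : rr i < Lc := by
    have := Fintype.mem_piFinset.1 hrr i
    simpa [Finset.mem_range] using this
  have h' : ((rr i : ℕ) : ℤ) < Lc := by exact_mod_cast h
  have h0 : (0 : ℤ) ≤ ((rr i : ℕ) : ℤ) := by exact_mod_cast Nat.zero_le _
  simp only [Pi.add_apply, Pi.smul_apply, smul_eq_mul, toSite]
  constructor <;> omega

/-- [folklore] The coarse translate of the root corner `Lc•y + ρ + Lc•e_μ`: `Lc·y ≤ · < Lc·y + 3Lc`. -/
theorem corner_le_root_add {rr : Fin (d + 1) → ℕ} (hrr : rr ∈ box (d + 1) Lc) (y : Site (d + 1)) (μ i : Fin (d + 1)) :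
    (Lc : ℤ) * y i ≤ ((Lc : ℤ) • y + toSite rr + (Lc : ℤ) • unitVec μ) i ∧
      ((Lc : ℤ) • y + toSite rr + (Lc : ℤ) • unitVec μ) i < (Lc : ℤ) * y i + 3 * Lc := by
  have h : rr i < Lc := by
    have := Fintype.mem_piFinset.1 hrr i
    simpa [Finset.mem_range] using this
  have h' : ((rr i : ℕ) : ℤ) < Lc := by exact_mod_cast h
  have h0 : (0 : ℤ) ≤ ((rr i : ℕ) : ℤ) := by exact_mod_cast Nat.zero_le _
  have hL0 : (0 : ℤ) ≤ Lc := by exact_mod_cast Nat.zero_le _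
  simp only [Pi.add_apply, Pi.smul_apply, smul_eq_mul, toSite, unitVec_apply]
  split_ifs <;> constructor <;> nlinarith

/-- [folklore] **THE LABEL OF A LIFTED BLOCK LABEL**: `quo (Lc^{n+1}) (Lc^{s+1} • blk (Lc^s) y′) = quo (Lc^n) y′` for `s ≤ n` (the fine point `Lc^{s+1}•w` of the
`Lc^{s+1}`-block `w = blk (Lc^s) y′` carries the level-`n+1` label of `y′`). -/
theorem quo_pow_smul_blk (hLc : 1 ≤ Lc) {s n : ℕ} (hs : s ≤ n) (y' : Site (d + 1)) :
    quo (Lc ^ (n + 1)) (((Lc ^ (s + 1) : ℕ) : ℤ) • blk (Lc ^ s) y') = quo (Lc ^ n) y' := by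
  have h0 : (fun _ : Fin (d + 1) => (0 : ℕ)) ∈ box (d + 1) (Lc ^ (s + 1)) := by
    have : 0 < Lc ^ (s + 1) := pow_pos hLc _
    simpa [AffineAveraging.box, Fintype.mem_piFinset, Finset.mem_range] using this
  -- `quo (Lc^{n+1}) = quo (Lc^{n−s}) ∘ quo (Lc^{s+1})`, `quo (Lc^{s+1}) (Lc^{s+1}•w + 0) = w`, `quo (Lc^{n−s}) (blk (Lc^s) y′) = quo (Lc^n) y′`
  have e1 : Lc ^ (n + 1) = Lc ^ (s + 1) * Lc ^ (n - s) := by rw [← pow_add]; congr 1; omega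
  have e2 : Lc ^ n = Lc ^ s * Lc ^ (n - s) := by rw [← pow_add]; congr 1; omega
  have hw : quo (Lc ^ (s + 1)) (((Lc ^ (s + 1) : ℕ) : ℤ) • blk (Lc ^ s) y') = blk (Lc ^ s) y' := by
    have h := blk_block (L := Lc ^ (s + 1)) (blk (Lc ^ s) y') h0
    have e0 : toSite (fun _ : Fin (d + 1) => (0 : ℕ)) = (0 : Site (d + 1)) := by funext i; simp [toSite]
    rw [e0, add_zero] at h
    exact h
  rw [e1, ← quo_quo, hw, e2, ← quo_quo]
  rfl

/-! ## §2 The finest piece on the support of the bond -/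

section Finest

variable {G : ℕ → Site (d + 1) → ℝ} {n : ℕ} {α κ₀ : ℝ} {z₀ : Site (d + 1)}

/-- [folklore] The finest piece at a point of the support: `|G 0 p| ≤ α·e^{2(d+1)κ₀}·E(y)` for `Lc·y ≤ p < Lc·y + 3Lc`. -/
theorem abs_finest_le_env (hLc : 1 ≤ Lc) (hκ : 0 ≤ κ₀) (hα : 0 ≤ α)
    (hG : ∀ s, s ≤ n → ∀ u, |G s (blk (Lc ^ s) u)| ≤ α * (Lc : ℝ) ^ s * Real.exp (-(κ₀ * supNorm (quo (Lc ^ (n + 1)) u - z₀))))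
    {y p : Site (d + 1)} (hp : ∀ i, (Lc : ℤ) * y i ≤ p i ∧ p i < (Lc : ℤ) * y i + 3 * Lc) :
    |G 0 p| ≤ α * (Real.exp (2 * ((d : ℝ) + 1) * κ₀) * Real.exp (-(κ₀ * supNorm (quo (Lc ^ n) y - z₀)))) := by
  have h := hG 0 (Nat.zero_le _) p
  rw [pow_zero, blk_one, pow_zero, mul_one] at h
  exact h.trans (mul_le_mul_of_nonneg_left (env_label_le hLc hκ n z₀ hp) hα)

/-- NOT IN PRINT; OUR BOOKKEEPING ([folklore]).  **THE FINEST-PIECE FOUR-SITE WEIGHT ON THE SUPPORT BOX, LOCALISED**: for pieces under the displayed letter, every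
`x ∈ nearBox Lc y`, every `a`, box root `ρ = toSite rr`:
`|G 0 x + G 0 (x+e_a) − G 0 (Lc•y+ρ) − G 0 (Lc•y+ρ+Lc•e_μ)| ≤ 4α·e^{2(d+1)κ₀}·e^{−κ₀‖quo (Lc^n) y − z₀‖∞}` — the hypothesis `hW` of PART 1 §3. -/
theorem abs_weight_finest_le_env (hLc : 1 ≤ Lc) (hκ : 0 ≤ κ₀) (hα : 0 ≤ α)
    (hG : ∀ s, s ≤ n → ∀ u, |G s (blk (Lc ^ s) u)| ≤ α * (Lc : ℝ) ^ s * Real.exp (-(κ₀ * supNorm (quo (Lc ^ (n + 1)) u - z₀))))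
    {rr : Fin (d + 1) → ℕ} (hrr : rr ∈ box (d + 1) Lc) (μ : Fin (d + 1)) (y : Site (d + 1)) (a : Fin (d + 1)) {x : Site (d + 1)}
    (hx : x ∈ nearBox Lc y) :
    |G 0 x + G 0 (x + unitVec a) - G 0 ((Lc : ℤ) • y + toSite rr) - G 0 ((Lc : ℤ) • y + toSite rr + (Lc : ℤ) • unitVec μ)|
      ≤ 4 * α * (Real.exp (2 * ((d : ℝ) + 1) * κ₀) * Real.exp (-(κ₀ * supNorm (quo (Lc ^ n) y - z₀)))) := by
  have h1 := abs_finest_le_env hLc hκ hα hG (corner_le_of_mem_nearBox hx)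
  have h2 := abs_finest_le_env hLc hκ hα hG (corner_le_of_mem_nearBox_add hLc hx a)
  have h3 := abs_finest_le_env hLc hκ hα hG (corner_le_root hrr y)
  have h4 := abs_finest_le_env hLc hκ hα hG (corner_le_root_add hrr y μ)
  calc |G 0 x + G 0 (x + unitVec a) - G 0 ((Lc : ℤ) • y + toSite rr) - G 0 ((Lc : ℤ) • y + toSite rr + (Lc : ℤ) • unitVec μ)|
      ≤ |G 0 x| + |G 0 (x + unitVec a)| + |G 0 ((Lc : ℤ) • y + toSite rr)| + |G 0 ((Lc : ℤ) • y + toSite rr + (Lc : ℤ) • unitVec μ)| := by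
        refine (abs_sub _ _).trans (add_le_add ((abs_sub _ _).trans (add_le_add (abs_add_le _ _) le_rfl)) le_rfl)
    _ ≤ _ := by linarith

/-- NOT IN PRINT; OUR BOOKKEEPING ([folklore]).  **THE FINEST-PIECE GRADIENT ON THE SUPPORT BOX, LOCALISED**: `|dz (G 0) a x| ≤ 2α·e^{2(d+1)κ₀}·e^{−κ₀‖quo (Lc^n) y − z₀‖∞}`
(`x ∈ nearBox Lc y`) — the hypothesis `hgb` of PART 1 §3 (ΔΔ). -/
theorem abs_dz_finest_le_env (hLc : 1 ≤ Lc) (hκ : 0 ≤ κ₀) (hα : 0 ≤ α)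
    (hG : ∀ s, s ≤ n → ∀ u, |G s (blk (Lc ^ s) u)| ≤ α * (Lc : ℝ) ^ s * Real.exp (-(κ₀ * supNorm (quo (Lc ^ (n + 1)) u - z₀))))
    (y : Site (d + 1)) (a : Fin (d + 1)) {x : Site (d + 1)} (hx : x ∈ nearBox Lc y) :
    |dz (G 0) a x| ≤ 2 * α * (Real.exp (2 * ((d : ℝ) + 1) * κ₀) * Real.exp (-(κ₀ * supNorm (quo (Lc ^ n) y - z₀)))) := by
  have h1 := abs_finest_le_env hLc hκ hα hG (corner_le_of_mem_nearBox hx)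
  have h2 := abs_finest_le_env hLc hκ hα hG (corner_le_of_mem_nearBox_add hLc hx a)
  simp only [dz]
  calc |G 0 (x + unitVec a) - G 0 x| ≤ |G 0 (x + unitVec a)| + |G 0 x| := abs_sub _ _
    _ ≤ _ := by linarith

end Finest

/-! ## §3 The jumps across the bond -/

section Jumps

variable {G : ℕ → Site (d + 1) → ℝ} {n : ℕ} {α κ₀ : ℝ} {z₀ : Site (d + 1)}

/-- [folklore] **A COARSE PIECE AT A BLOCK LABEL NEAR THE BOND, LOCALISED**: for `s < n` and any `y′`,
`|G (s+1) (blk (Lc^s) y′)| ≤ α·Lc^{s+1}·(e^{κ₀|y′−y|₁}·e^{−κ₀‖quo (Lc^n) y − z₀‖∞})` (the block label is the label of the fine point `Lc^{s+1}•blk (Lc^s) y′`, whose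
level-`(n+1)` label is `quo (Lc^n) y′`; then leaf-12's wobble to `y`). -/
theorem abs_piece_blk_le_env (hLc : 1 ≤ Lc) (hκ : 0 ≤ κ₀) (hα : 0 ≤ α)
    (hG : ∀ s, s ≤ n → ∀ u, |G s (blk (Lc ^ s) u)| ≤ α * (Lc : ℝ) ^ s * Real.exp (-(κ₀ * supNorm (quo (Lc ^ (n + 1)) u - z₀))))
    {s : ℕ} (hs : s < n) (y y' : Site (d + 1)) :
    |G (s + 1) (blk (Lc ^ s) y')| ≤ α * (Lc : ℝ) ^ (s + 1) *
      (Real.exp (κ₀ * l1 (y' - y)) * Real.exp (-(κ₀ * supNorm (quo (Lc ^ n) y - z₀)))) := by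
  have hLn : 1 ≤ Lc ^ n := Nat.one_le_pow _ _ hLc
  -- the block label as the label of a fine point
  have h0 : (fun _ : Fin (d + 1) => (0 : ℕ)) ∈ box (d + 1) (Lc ^ (s + 1)) := by
    have : 0 < Lc ^ (s + 1) := pow_pos hLc _
    simpa [AffineAveraging.box, Fintype.mem_piFinset, Finset.mem_range] using this
  have hw : blk (Lc ^ (s + 1)) (((Lc ^ (s + 1) : ℕ) : ℤ) • blk (Lc ^ s) y') = blk (Lc ^ s) y' := by
    have h := blk_block (L := Lc ^ (s + 1)) (blk (Lc ^ s) y') h0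
    have e0 : toSite (fun _ : Fin (d + 1) => (0 : ℕ)) = (0 : Site (d + 1)) := by funext i; simp [toSite]
    rw [e0, add_zero] at h
    exact h
  have h := hG (s + 1) (by omega) (((Lc ^ (s + 1) : ℕ) : ℤ) • blk (Lc ^ s) y')
  rw [hw, quo_pow_smul_blk hLc (by omega : s ≤ n)] at h
  refine h.trans (mul_le_mul_of_nonneg_left ?_ (by positivity))
  exact env_wobble (L := Lc ^ n) hLn hκ z₀ y y'

/-- NOT IN PRINT; OUR BOOKKEEPING ([folklore]).  **THE JUMP OF THE SCALE-`(s+1)` PIECE ACROSS THE BOND, LOCALISED AND ON THE CROSSED SCALES ONLY** (`s < n`):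
`|G (s+1) (blk (Lc^s) (y+e_μ)) − G (s+1) (blk (Lc^s) y)| ≤ [Lc^s ∣ y_μ+1]·(2·(α·Lc^{s+1}))·(e^{2(d+1)κ₀}·E(y))` (leaf-01's `jump_eq_zero_of_not_dvd` off the faces). -/
theorem abs_jump_le_ite_env (hLc : 1 ≤ Lc) (hκ : 0 ≤ κ₀) (hα : 0 ≤ α)
    (hG : ∀ s, s ≤ n → ∀ u, |G s (blk (Lc ^ s) u)| ≤ α * (Lc : ℝ) ^ s * Real.exp (-(κ₀ * supNorm (quo (Lc ^ (n + 1)) u - z₀))))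
    {s : ℕ} (hs : s < n) (μ : Fin (d + 1)) (y : Site (d + 1)) :
    |G (s + 1) (blk (Lc ^ s) (y + unitVec μ)) - G (s + 1) (blk (Lc ^ s) y)|
      ≤ (if (Lc : ℤ) ^ s ∣ y μ + 1 then 2 * (α * (Lc : ℝ) ^ (s + 1)) else 0) *
          (Real.exp (2 * ((d : ℝ) + 1) * κ₀) * Real.exp (-(κ₀ * supNorm (quo (Lc ^ n) y - z₀)))) := by
  split_ifs with hdvd
  · have h1 := abs_piece_blk_le_env hLc hκ hα hG hs y (y + unitVec μ)
    have h2 := abs_piece_blk_le_env hLc hκ hα hG hs y y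
    rw [add_sub_cancel_left, l1_unitVec_eq_one] at h1
    rw [sub_self] at h2
    have hl0 : l1 (0 : Site (d + 1)) = 0 := by simp [l1]
    rw [hl0, mul_zero, Real.exp_zero, one_mul] at h2
    -- both wobble factors `≤ e^{2(d+1)κ₀}`
    have hD : (1 : ℝ) ≤ 2 * ((d : ℝ) + 1) := by have := Nat.cast_nonneg (α := ℝ) d; linarith
    have hw1 : Real.exp (κ₀ * 1) ≤ Real.exp (2 * ((d : ℝ) + 1) * κ₀) := Real.exp_le_exp.2 (by nlinarith)
    have hw0 : (1 : ℝ) ≤ Real.exp (2 * ((d : ℝ) + 1) * κ₀) := Real.one_le_exp (by positivity)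
    have hE := (Real.exp_pos (-(κ₀ * supNorm (quo (Lc ^ n) y - z₀)))).le
    have hαL : 0 ≤ α * (Lc : ℝ) ^ (s + 1) := by positivity
    calc |G (s + 1) (blk (Lc ^ s) (y + unitVec μ)) - G (s + 1) (blk (Lc ^ s) y)|
        ≤ |G (s + 1) (blk (Lc ^ s) (y + unitVec μ))| + |G (s + 1) (blk (Lc ^ s) y)| := abs_sub _ _
      _ ≤ α * (Lc : ℝ) ^ (s + 1) * (Real.exp (κ₀ * 1) * Real.exp (-(κ₀ * supNorm (quo (Lc ^ n) y - z₀))))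
          + α * (Lc : ℝ) ^ (s + 1) * Real.exp (-(κ₀ * supNorm (quo (Lc ^ n) y - z₀))) := add_le_add h1 h2
      _ ≤ α * (Lc : ℝ) ^ (s + 1) * (Real.exp (2 * ((d : ℝ) + 1) * κ₀) * Real.exp (-(κ₀ * supNorm (quo (Lc ^ n) y - z₀))))
          + α * (Lc : ℝ) ^ (s + 1) * (Real.exp (2 * ((d : ℝ) + 1) * κ₀) * Real.exp (-(κ₀ * supNorm (quo (Lc ^ n) y - z₀)))) := by
          gcongr
          exact le_mul_of_one_le_left hE hw0
      _ = 2 * (α * (Lc : ℝ) ^ (s + 1)) * (Real.exp (2 * ((d : ℝ) + 1) * κ₀) * Real.exp (-(κ₀ * supNorm (quo (Lc ^ n) y - z₀)))) := by ring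
  · rw [jump_eq_zero_of_not_dvd hLc G s hdvd, abs_zero, zero_mul]

/-- NOT IN PRINT; OUR BOOKKEEPING ([folklore]).  **THE JUMP SUM ACROSS THE BOND `(μ,y)`, LOCALISED** — leaf-03's face letter `F_μ(y) = Σ_{s<n} [Lc^s ∣ y_μ+1]·2·a (s+1)` with
`a (s+1) = α·Lc^{s+1}` VERBATIM, times ONE envelope value of the bond:
`Σ_{s<n} |G (s+1) (blk (Lc^s) (y+e_μ)) − G (s+1) (blk (Lc^s) y)| ≤ (Σ_{s<n} [Lc^s ∣ y_μ+1]·2·(α·Lc^{s+1}))·(e^{2(d+1)κ₀}·e^{−κ₀‖quo (Lc^n) y − z₀‖∞})` — the hypothesis `hJ` of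
PART 1 §3 (the localised twin of leaf-01's `sum_abs_jump_routeGauge_le_three`, whose envelope is dropped to `1`). -/
theorem sum_abs_jump_le_env (hLc : 1 ≤ Lc) (hκ : 0 ≤ κ₀) (hα : 0 ≤ α)
    (hG : ∀ s, s ≤ n → ∀ u, |G s (blk (Lc ^ s) u)| ≤ α * (Lc : ℝ) ^ s * Real.exp (-(κ₀ * supNorm (quo (Lc ^ (n + 1)) u - z₀))))
    (μ : Fin (d + 1)) (y : Site (d + 1)) :
    ∑ s ∈ Finset.range n, |G (s + 1) (blk (Lc ^ s) (y + unitVec μ)) - G (s + 1) (blk (Lc ^ s) y)|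
      ≤ (∑ s ∈ Finset.range n, (if (Lc : ℤ) ^ s ∣ y μ + 1 then 2 * (α * (Lc : ℝ) ^ (s + 1)) else 0)) *
          (Real.exp (2 * ((d : ℝ) + 1) * κ₀) * Real.exp (-(κ₀ * supNorm (quo (Lc ^ n) y - z₀)))) := by
  rw [Finset.sum_mul]
  exact Finset.sum_le_sum fun s hs => abs_jump_le_ite_env hLc hκ hα hG (Finset.mem_range.1 hs) μ y

end Jumps

end Summit.QuantumFields.BalabanUV.Beta.GAN24.ContactGaugeStaircaseLocal

end
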